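import Literature.Computability.AlgebraicComplexity.TokenExpansionSteps
import HarnessLib

/-!
# The token expansion of a normalized circuit, III: sum nodes

The step of the cut induction at a node of kind `add a b`: the consistent extensions are
`βadd β T`, `T ⊆` demanded offsets (the clones in `T` pass their demand to `a`, the others to
`b`), each with node product `1`; every other extension kills a factor
(`prodAt_eq_zero_of_ne_add`, via `Tof`); `∑_{T} ∏_{T} val a ∏_{∁T} val b = ∏ (val a + val b)`
(`Finset.prod_add`) gives `step_add`. Also the general validity lemma `valid_of_ext`.

## References

* G. Malod, N. Portier, *Characterizing Valiant's algebraic complexity classes*, J. Complexity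
  24 (2008) 16–38: Lemma 2 (reduced circuits) and Thm. 2 with its proof (the local conditions
  (1)–(4) of a parse tree, pp. 8–9 of the MFCS 2006 version).
* P. Bürgisser, *On defining integers and proving arithmetic circuit lower bounds*,
  Comput. Complexity 18 (2009) 81–103, Thm. 2.10 (ECCC TR06-113, p. 8).
-/

namespace Literature.Computability.AlgebraicComplexity

open Finset

universe u

namespace NCirc

variable {R : Type u} [CommRing R] (N : NCirc R) (D : ℕ) (hD : 1 ≤ D) (hm : 0 < N.m)

/-! ### The step at a sum node -/

section StepAdd

variable {k : ℕ} {a b : ℕ}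

/-- **The consistent extensions at a sum node**: every demanded clone passes its demand to ONE
child — to `a` for the clones in `T`, to `b` for the other demanded clones. [cite: MalodPortier2008, Thm. 2] -/
noncomputable def βadd (hk : k < N.m) (β : N.Var D → Bool) (T : Finset (Fin (D + 1))) : N.Var D → Bool :=
  fun v => match v with
  | Sum.inl τ => if τ.1.1.1.val = k then
        (if τ.1.2 = 0 then decide (τ.1.1.2 ∈ T) else (N.sdem D hk β τ.1.1.2 && !decide (τ.1.1.2 ∈ T)))
      else if k < τ.1.1.1.val then β (Sum.inl τ) else false
  | Sum.inr w => if k < N.src D (Sum.inr w) then β (Sum.inr w) else false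

/-- `βadd` agrees with `β` above `k`. [folklore] -/
theorem βadd_above (hk : k < N.m) (β : N.Var D → Bool) (T : Finset (Fin (D + 1))) (v : N.Var D)
    (hv : k < N.src D v) : N.βadd D hk β T v = β v := by
  rcases v with τ | w
  · simp only [src] at hv
    simp only [βadd]
    rw [if_neg (by omega), if_pos hv]
  · simp only [βadd]
    rw [if_pos hv]

/-- `βadd` vanishes below `k`. [folklore] -/
theorem βadd_below (hk : k < N.m) (β : N.Var D → Bool) (T : Finset (Fin (D + 1))) (v : N.Var D)
    (hv : N.src D v < k) : N.βadd D hk β T v = false := by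
  rcases v with τ | w
  · simp only [src] at hv
    simp only [βadd]
    rw [if_neg (by omega), if_neg (by omega)]
  · simp only [βadd]
    rw [if_neg (by omega)]

/-- `βadd` on the tokens of node `k`. [folklore] -/
theorem βadd_tokK (hk : k < N.m) (β : N.Var D → Bool) (T : Finset (Fin (D + 1))) (c : Fin (D + 1))
    (hv : N.CValid D (N.cl D hk c)) (j : Fin 2) (hj : j.val < (N.kind k).ar) :
    N.βadd D hk β T (N.tokK D hk c hv j hj) =
      if j = 0 then decide (c ∈ T) else (N.sdem D hk β c && !decide (c ∈ T)) := by
  simp [βadd, tokK, cl]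

/-- `βadd T ∈ Ext_k β`. [folklore] -/
theorem βadd_mem_Ext (hk : k < N.m) (β : N.Var D → Bool) (T : Finset (Fin (D + 1))) :
    N.βadd D hk β T ∈ N.Ext D k β := by
  unfold Ext
  rw [Finset.mem_filter]
  exact ⟨Finset.mem_univ _, fun v hv => N.βadd_above D hk β T v (by omega), N.βadd_below D hk β T⟩

/-- The value of a valid sum clone factor. [folklore] -/
theorem spec_cl_add (hk : k < N.m) (hkind : N.kind k = NK.add a b) (c : Fin (D + 1))
    (hv : N.CValid D (N.cl D hk c)) (b' : N.Var D → Bool) :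
    (N.cloneKind D (N.cl D hk c)).spec b' =
      if (N.ins D (N.cl D hk c)).any b' then
        (if b' (N.tokK D hk c hv 0 (by rw [hkind]; exact Nat.zero_lt_two)) ≠
            b' (N.tokK D hk c hv 1 (by rw [hkind]; exact Nat.one_lt_two)) then 1 else 0)
      else (if b' (N.tokK D hk c hv 0 (by rw [hkind]; exact Nat.zero_lt_two)) = false ∧
            b' (N.tokK D hk c hv 1 (by rw [hkind]; exact Nat.one_lt_two)) = false then 1 else 0) := by
  rw [N.cloneKind_eq D _ hv (show N.kind (N.cl D hk c).1.val = NK.add a b from hkind)]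
  rfl

/-- `prodAt` of a consistent extension at a sum node is `1`. [folklore] -/
theorem prodAt_βadd (hk : k < N.m) (hku : N.u ≤ k) (hkind : N.kind k = NK.add a b) (hm' : 0 < N.m)
    (hroot : N.fd (N.m - 1) ≤ D) (F : Fin (N.mF D) → (N.Var D → Bool) → R)
    (hF : (N.FS D hD hm' hroot).Admissible F) (β : N.Var D → Bool) (hval : N.Valid D (k + 1) β)
    (T : Finset (Fin (D + 1))) (hT : T ⊆ N.Sdem D hk β) : N.prodAt D F k (N.βadd D hk β T) = 1 := by
  rw [N.prodAt_eq D hk hku]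
  refine Finset.prod_eq_one fun c _ => ?_
  rw [N.F_cl_eq_spec D hD hm' hk hroot F hF β hval _ (fun v hv => N.βadd_above D hk β T v hv)]
  by_cases hv : N.CValid D (N.cl D hk c)
  · rw [N.spec_cl_add D hk hkind c hv, N.any_ins_congr D hk β _ (fun v hv => N.βadd_above D hk β T v hv),
      N.βadd_tokK D hk, N.βadd_tokK D hk, if_pos rfl, if_neg (show ¬ ((1 : Fin 2) = 0) by decide)]
    by_cases hc : c ∈ T
    · have hs : N.sdem D hk β c = true := (N.mem_Sdem D hk β c).1 (hT hc)
      simp [hs, hc]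
    · cases hs : N.sdem D hk β c <;> simp [hc]
  · rw [N.cloneKind_of_not D _ hv]
    simp [FKind.spec]

/-- The subset read off from an extension: the demanded clones whose first token is set. [folklore] -/
noncomputable def Tof (hk : k < N.m) (hkind : N.kind k = NK.add a b) (hm' : 0 < N.m) (hroot : N.fd (N.m - 1) ≤ D)
    (β β' : N.Var D → Bool) : Finset (Fin (D + 1)) :=
  (N.Sdem D hk β).attach.image Subtype.val |>.filter fun c =>
    ∃ hc : N.sdem D hk β c = true,
      β' (N.tokK D hk c (N.cvalid_of_sdem D hk hm' hroot β c hc) 0 (by rw [hkind]; exact Nat.zero_lt_two)) = true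

/-- `Tof ⊆ Sdem`. [folklore] -/
theorem Tof_subset (hk : k < N.m) (hkind : N.kind k = NK.add a b) (hm' : 0 < N.m)
    (hroot : N.fd (N.m - 1) ≤ D) (β β' : N.Var D → Bool) :
    N.Tof D hk hkind hm' hroot β β' ⊆ N.Sdem D hk β := by
  intro c hc
  unfold Tof at hc
  rw [Finset.mem_filter, Finset.mem_image] at hc
  obtain ⟨⟨⟨c', hc'⟩, -, rfl⟩, -⟩ := hc
  exact hc'

/-- Membership in `Tof`. [folklore] -/
theorem mem_Tof (hk : k < N.m) (hkind : N.kind k = NK.add a b) (hm' : 0 < N.m)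
    (hroot : N.fd (N.m - 1) ≤ D) (β β' : N.Var D → Bool) (c : Fin (D + 1))
    (hv : N.CValid D (N.cl D hk c)) :
    c ∈ N.Tof D hk hkind hm' hroot β β' ↔ N.sdem D hk β c = true ∧
      β' (N.tokK D hk c hv 0 (by rw [hkind]; exact Nat.zero_lt_two)) = true := by
  unfold Tof
  rw [Finset.mem_filter, Finset.mem_image]
  constructor
  · rintro ⟨-, hc, h⟩
    exact ⟨hc, h⟩
  · rintro ⟨hc, h⟩
    exact ⟨⟨⟨c, (N.mem_Sdem D hk β c).2 hc⟩, Finset.mem_attach _ _, rfl⟩, hc, h⟩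

/-- The Boolean heart of the sum-clone factor: any deviation from the consistent pattern kills it. [folklore] -/
theorem add_kill (s p0 p1 : Bool) (inT : Prop) [Decidable inT] (hT : inT ↔ s = true ∧ p0 = true)
    (hv : p0 ≠ decide inT ∨ p1 ≠ (s && !decide inT)) :
    (if s = true then (if p0 ≠ p1 then (1 : R) else 0)
      else (if p0 = false ∧ p1 = false then 1 else 0)) = 0 := by
  by_cases hi : inT <;> cases s <;> cases p0 <;> cases p1 <;> simp_all

/-- **An extension with a non-vanishing node product is consistent**: it is `βadd (Tof β')`. [folklore] -/
theorem prodAt_eq_zero_of_ne_add (hk : k < N.m) (hku : N.u ≤ k) (hkind : N.kind k = NK.add a b)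
    (hm' : 0 < N.m) (hroot : N.fd (N.m - 1) ≤ D) (F : Fin (N.mF D) → (N.Var D → Bool) → R)
    (hF : (N.FS D hD hm' hroot).Admissible F) (β : N.Var D → Bool) (hval : N.Valid D (k + 1) β)
    (β' : N.Var D → Bool) (hβ' : β' ∈ N.Ext D k β)
    (hne : β' ≠ N.βadd D hk β (N.Tof D hk hkind hm' hroot β β')) : N.prodAt D F k β' = 0 := by
  have hb' := N.agree_of_mem_Ext D β β' hβ'
  -- a token of node `k` where they differ
  obtain ⟨v, hv⟩ : ∃ v, β' v ≠ N.βadd D hk β (N.Tof D hk hkind hm' hroot β β') v := Function.ne_iff.1 hne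
  have hs : N.src D v = k := by
    unfold Ext at hβ'
    rw [Finset.mem_filter] at hβ'
    by_contra hs
    rcases Nat.lt_or_gt_of_ne hs with hlt | hgt
    · exact hv (by rw [hβ'.2.2 v hlt, N.βadd_below D hk β _ v hlt])
    · exact hv (by rw [hb' v hgt, N.βadd_above D hk β _ v hgt])
  obtain ⟨τ, rfl, hτ⟩ := N.exists_tok_of_src D hk hku v hs
  have hvalid : N.CValid D (N.cl D hk τ.1.1.2) := hτ ▸ τ.2.1
  have hj : τ.1.2.val < (N.kind k).ar := by have := τ.2.2; rw [hτ] at this; exact this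
  have hτeq : (Sum.inl τ : N.Var D) = N.tokK D hk τ.1.1.2 hvalid τ.1.2 hj := by
    unfold tokK; congr 1; exact Subtype.ext (Prod.ext hτ rfl)
  set c := τ.1.1.2
  rw [hτeq, N.βadd_tokK D hk] at hv
  rw [N.prodAt_eq D hk hku]
  refine Finset.prod_eq_zero (Finset.mem_univ c) ?_
  rw [N.F_cl_eq_spec D hD hm' hk hroot F hF β hval _ hb', N.spec_cl_add D hk hkind c hvalid,
    N.any_ins_congr D hk β _ hb']
  have hT := N.mem_Tof D hk hkind hm' hroot β β' c hvalid
  -- name the two token values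
  have e0 : ∀ hj', N.tokK D hk c hvalid 0 hj' = N.tokK D hk c hvalid 0 (by rw [hkind]; exact Nat.zero_lt_two) :=
    fun _ => rfl
  have e1 : ∀ hj', N.tokK D hk c hvalid 1 hj' = N.tokK D hk c hvalid 1 (by rw [hkind]; exact Nat.one_lt_two) :=
    fun _ => rfl
  generalize hjq : τ.1.2 = j at hj hv
  have h2 : j = 0 ∨ j = 1 := by omega
  refine add_kill (R := R) _ _ _ (c ∈ N.Tof D hk hkind hm' hroot β β') hT ?_
  rcases h2 with rfl | rfl
  · rw [if_pos rfl, e0] at hv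
    exact Or.inl hv
  · rw [if_neg (show ¬ ((1 : Fin 2) = 0) by decide), e1] at hv
    exact Or.inr hv

end StepAdd

section StepAdd2

variable {k : ℕ} {a b : ℕ}

/-- The new out-tokens of any extension are tokens `tokK c j` set by it. [folklore] -/
theorem mem_newOut_iff_tokK (hk : k < N.m) (hku : N.u ≤ k) (γ : N.Var D → Bool) (w : N.Var D) :
    w ∈ N.newOut D k γ ↔ ∃ (c : Fin (D + 1)) (hv : N.CValid D (N.cl D hk c)) (j : Fin 2)
      (hj : j.val < (N.kind k).ar), w = N.tokK D hk c hv j hj ∧ γ (N.tokK D hk c hv j hj) = true := by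
  unfold newOut
  rw [Finset.mem_filter]
  simp only [Finset.mem_univ, true_and]
  constructor
  · rintro ⟨hb, hs, -⟩
    obtain ⟨τ, rfl, hτ⟩ := N.exists_tok_of_src D hk hku w hs
    have hvalid : N.CValid D (N.cl D hk τ.1.1.2) := hτ ▸ τ.2.1
    have hj : τ.1.2.val < (N.kind k).ar := by have := τ.2.2; rw [hτ] at this; exact this
    have hτeq : (Sum.inl τ : N.Var D) = N.tokK D hk τ.1.1.2 hvalid τ.1.2 hj := by
      unfold tokK; congr 1; exact Subtype.ext (Prod.ext hτ rfl)
    exact ⟨_, hvalid, _, hj, hτeq, hτeq ▸ hb⟩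
  · rintro ⟨c, hv, j, hj, rfl, hb⟩
    exact ⟨hb, rfl, by simp [tokK, tgtV]⟩

/-- **Validity of a consistent extension across the cut `k`** (general form): if every set
token of node `k` leaves a demanded clone, and distinct set tokens of one clone have disjoint
target ranges, the extension is a valid demand. [cite: MalodPortier2008, Lemma 2] -/
theorem valid_of_ext (hk : k < N.m) (hku : N.u ≤ k) (β : N.Var D → Bool) (hval : N.Valid D (k + 1) β)
    (γ : N.Var D → Bool) (hγ : γ ∈ N.Ext D k β)
    (hdem : ∀ c hv j hj, γ (N.tokK D hk c hv j hj) = true → N.sdem D hk β c = true)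
    (hsib : ∀ c hv j hj j' hj', j ≠ j' → γ (N.tokK D hk c hv j hj) = true →
      γ (N.tokK D hk c hv j' hj') = true →
      Disjoint (N.rangeOf (N.tgtN D (N.tokK D hk c hv j hj))) (N.rangeOf (N.tgtN D (N.tokK D hk c hv j' hj')))) :
    N.Valid D k γ := by
  have hlow : ∀ v ∈ N.demLow D k β, v ∈ N.dem D (k + 1) β ∧ (N.tgtN D v).1 < k := fun v hv =>
    Finset.mem_filter.1 hv
  have hmix : ∀ v ∈ N.demLow D k β, ∀ (c : Fin (D + 1)) (hv : N.CValid D (N.cl D hk c)) (j : Fin 2)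
      (hj : j.val < (N.kind k).ar), γ (N.tokK D hk c hv j hj) = true →
      Disjoint (N.rangeOf (N.tgtN D v)) (N.rangeOf (N.tgtN D (N.tokK D hk c hv j hj))) := by
    intro v hv c hvc j hj hb
    obtain ⟨x, hx, hxt⟩ := N.exists_dem_of_sdem D hk β c (hdem c hvc j hj hb)
    have hne : v ≠ x := fun h => by
      have := (hlow v hv).2
      rw [h, hxt] at this
      exact lt_irrefl _ this
    have hd := hval v (hlow v hv).1 x hx hne
    rw [hxt] at hd
    exact hd.mono_right (N.rangeOf_tokK_subset D hk c _ j hj)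
  intro v hv w hw hne
  rw [N.dem_of_ext D hk β _ hγ, Finset.mem_union, N.mem_newOut_iff_tokK D hk hku] at hv hw
  rcases hv with hv | ⟨c, hvc, j, hj, rfl, hb⟩ <;> rcases hw with hw | ⟨c', hvc', j', hj', rfl, hb'⟩
  · exact hval v (hlow v hv).1 w (hlow w hw).1 hne
  · exact hmix v hv c' hvc' j' hj' hb'
  · exact (hmix w hw c hvc j hj hb).symm
  · by_cases hcc : c = c'
    · subst hcc
      have hjj : j ≠ j' := fun h => hne (by subst h; rfl)
      exact hsib c hvc j hj j' hj' hjj hb hb'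
    · obtain ⟨x, hx, hxt⟩ := N.exists_dem_of_sdem D hk β c (hdem c hvc j hj hb)
      obtain ⟨x', hx', hxt'⟩ := N.exists_dem_of_sdem D hk β c' (hdem c' hvc' j' hj' hb')
      have hxx : x ≠ x' := fun h => hcc (by
        rw [h, hxt'] at hxt
        exact Fin.ext (by simpa using (Prod.mk.inj hxt).2.symm))
      have hd := hval x hx x' hx' hxx
      rw [hxt, hxt'] at hd
      exact (hd.mono_left (N.rangeOf_tokK_subset D hk c _ j hj)).mono_right
        (N.rangeOf_tokK_subset D hk c' _ j' hj')

/-- `βadd` is injective on the subsets of the demanded offsets. [folklore] -/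
theorem βadd_injOn (hk : k < N.m) (hkind : N.kind k = NK.add a b) (hm' : 0 < N.m)
    (hroot : N.fd (N.m - 1) ≤ D) (β : N.Var D → Bool) :
    Set.InjOn (N.βadd D hk β) ↑(N.Sdem D hk β).powerset := by
  intro T hT T' hT' h
  rw [Finset.coe_powerset, Set.mem_preimage, Set.mem_powerset_iff, Finset.coe_subset] at hT hT'
  ext c
  by_cases hc : c ∈ N.Sdem D hk β
  · have hv := N.cvalid_of_sdem D hk hm' hroot β c ((N.mem_Sdem D hk β c).1 hc)
    have h0 : (0 : Fin 2).val < (N.kind k).ar := by rw [hkind]; exact Nat.zero_lt_two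
    have := congrFun h (N.tokK D hk c hv 0 h0)
    rw [N.βadd_tokK D hk, N.βadd_tokK D hk, if_pos rfl, if_pos rfl] at this
    simpa using this
  · exact ⟨fun h' => absurd (hT h') hc, fun h' => absurd (hT' h') hc⟩

/-- **The fibre sum at a sum node**: `∑_{β' ∈ Ext} prodAt·W = ∑_{T ⊆ Sdem} W_k(βadd T)`. [folklore] -/
theorem sum_Ext_add (hk : k < N.m) (hku : N.u ≤ k) (hkind : N.kind k = NK.add a b) (hm' : 0 < N.m)
    (hroot : N.fd (N.m - 1) ≤ D) (F : Fin (N.mF D) → (N.Var D → Bool) → R)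
    (hF : (N.FS D hD hm' hroot).Admissible F) (β : N.Var D → Bool) (hval : N.Valid D (k + 1) β) :
    ∑ β' ∈ N.Ext D k β, N.prodAt D F k β' * N.W D F k β' =
      ∑ T ∈ (N.Sdem D hk β).powerset, N.W D F k (N.βadd D hk β T) := by
  rw [← Finset.sum_subset (Finset.image_subset_iff.2 fun T _ => N.βadd_mem_Ext D hk β T)
    (fun β' hβ' hni => ?_), Finset.sum_image (N.βadd_injOn D hk hkind hm' hroot β)]
  · refine Finset.sum_congr rfl fun T hT => ?_
    rw [N.prodAt_βadd D hD hk hku hkind hm' hroot F hF β hval T (Finset.mem_powerset.1 hT), one_mul]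
  · rw [N.prodAt_eq_zero_of_ne_add D hD hk hku hkind hm' hroot F hF β hval β' hβ' (fun h => hni ?_),
      zero_mul]
    exact Finset.mem_image.2 ⟨_, Finset.mem_powerset.2 (N.Tof_subset D hk hkind hm' hroot β β'), h.symm⟩

end StepAdd2

section StepAdd3

variable {k : ℕ} {a b : ℕ}

/-- The target node of a token of a sum clone: `a` or `b`. [folklore] -/
theorem tgtN_tokK_add (hk : k < N.m) (hkind : N.kind k = NK.add a b) (c : Fin (D + 1))
    (hv : N.CValid D (N.cl D hk c)) (j : Fin 2) (hj : j.val < (N.kind k).ar) :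
    (N.tgtN D (N.tokK D hk c hv j hj)).1 = if j = 0 then a else b := by
  simp only [tokK, tgtN, tgtV, Option.getD_some, tgt, cl]
  simp only [hkind, tgtOf]
  have : j = 0 ∨ j = 1 := by omega
  rcases this with rfl | rfl <;> simp

/-- **The product over the new out-tokens of `βadd T`**: `∏_{c ∈ T} val_e a · ∏_{c ∈ Sdem ∖ T} val_e b`. [folklore] -/
theorem prod_newOut_βadd (hk : k < N.m) (hku : N.u ≤ k) (hkind : N.kind k = NK.add a b) (hm' : 0 < N.m)
    (hroot : N.fd (N.m - 1) ≤ D) (β : N.Var D → Bool) (T : Finset (Fin (D + 1)))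
    (hT : T ⊆ N.Sdem D hk β) (e : Fin N.u → Bool) :
    ∏ v ∈ N.newOut D k (N.βadd D hk β T), N.val (N.ext e) (N.tgtN D v).1 =
      (∏ _c ∈ T, N.val (N.ext e) a) * ∏ _c ∈ N.Sdem D hk β \ T, N.val (N.ext e) b := by
  have h0 : (0 : Fin 2).val < (N.kind k).ar := by rw [hkind]; exact Nat.zero_lt_two
  have h1 : (1 : Fin 2).val < (N.kind k).ar := by rw [hkind]; exact Nat.one_lt_two
  have hvS : ∀ c : {c // c ∈ N.Sdem D hk β}, N.CValid D (N.cl D hk c.1) := fun c =>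
    N.cvalid_of_sdem D hk hm' hroot β c.1 ((N.mem_Sdem D hk β _).1 c.2)
  have himg : N.newOut D k (N.βadd D hk β T) = (N.Sdem D hk β).attach.image
      (fun c => if c.1 ∈ T then N.tokK D hk c.1 (hvS c) 0 h0 else N.tokK D hk c.1 (hvS c) 1 h1) := by
    ext w
    rw [N.mem_newOut_iff_tokK D hk hku, Finset.mem_image]
    constructor
    · rintro ⟨c, hv, j, hj, rfl, hb⟩
      rw [N.βadd_tokK D hk] at hb
      have h2 : j = 0 ∨ j = 1 := by omega
      rcases h2 with rfl | rfl
      · rw [if_pos rfl, decide_eq_true_eq] at hb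
        exact ⟨⟨c, hT hb⟩, Finset.mem_attach _ _, by simp only [hb, if_true]⟩
      · rw [if_neg (show ¬ ((1 : Fin 2) = 0) by decide), Bool.and_eq_true] at hb
        have hc : c ∉ T := by simpa using hb.2
        exact ⟨⟨c, (N.mem_Sdem D hk β c).2 hb.1⟩, Finset.mem_attach _ _, by simp only [hc, if_false]⟩
    · rintro ⟨⟨c, hc⟩, -, rfl⟩
      by_cases hcT : c ∈ T
      · refine ⟨c, hvS ⟨c, hc⟩, 0, h0, by simp [hcT], ?_⟩
        rw [N.βadd_tokK D hk, if_pos rfl]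
        simpa using hcT
      · refine ⟨c, hvS ⟨c, hc⟩, 1, h1, by simp [hcT], ?_⟩
        rw [N.βadd_tokK D hk, if_neg (show ¬ ((1 : Fin 2) = 0) by decide)]
        simpa [hcT] using (N.mem_Sdem D hk β c).1 hc
  rw [himg, Finset.prod_image]
  · have : ∀ c ∈ (N.Sdem D hk β).attach,
        N.val (N.ext e) (N.tgtN D (if c.1 ∈ T then N.tokK D hk c.1 (hvS c) 0 h0
          else N.tokK D hk c.1 (hvS c) 1 h1)).1 =
        (fun c : Fin (D + 1) => if c ∈ T then N.val (N.ext e) a else N.val (N.ext e) b) c.1 := by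
      intro c _
      by_cases hc : c.1 ∈ T
      · simp only [hc, if_true, N.tgtN_tokK_add D hk hkind]
      · simp only [hc, if_false, N.tgtN_tokK_add D hk hkind, if_neg (show ¬ ((1 : Fin 2) = 0) by decide)]
    rw [Finset.prod_congr rfl this, Finset.prod_attach (N.Sdem D hk β)
      (f := fun c : Fin (D + 1) => if c ∈ T then N.val (N.ext e) a else N.val (N.ext e) b),
      Finset.prod_ite, Finset.filter_mem_eq_inter, Finset.inter_eq_right.2 hT]
    congr 1
    refine Finset.prod_congr ?_ fun _ _ => rfl
    ext c
    simp [Finset.mem_sdiff]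
  · rintro ⟨c, hc⟩ - ⟨c', hc'⟩ - h
    apply Subtype.ext
    simp only at h
    split_ifs at h with h₁ h₂ h₂
    · exact (N.tokK_inj D hk h).1
    · exact (N.tokK_inj D hk h).1
    · exact (N.tokK_inj D hk h).1
    · exact (N.tokK_inj D hk h).1

/-- **`∑_{T ⊆ Sdem} RHS_k(βadd T) = RHS_{k+1}(β)`** by `∏ (val a + val b) = ∑_T ∏_T val a ∏ val b`. [folklore] -/
theorem sum_RHS_βadd (hk : k < N.m) (hku : N.u ≤ k) (hkind : N.kind k = NK.add a b) (hm' : 0 < N.m)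
    (hroot : N.fd (N.m - 1) ≤ D) (β : N.Var D → Bool) (hval : N.Valid D (k + 1) β) :
    ∑ T ∈ (N.Sdem D hk β).powerset, N.RHS D k (N.βadd D hk β T) = N.RHS D (k + 1) β := by
  rw [N.RHS_succ_eq D k β]
  unfold RHS
  rw [N.Rep_succ_of_le hku, Finset.sum_comm]
  refine Finset.sum_congr rfl fun e _ => ?_
  have : ∀ T ∈ (N.Sdem D hk β).powerset,
      ∏ v ∈ N.dem D k (N.βadd D hk β T), N.val (N.ext e) (N.tgtN D v).1 =
        (∏ v ∈ N.demLow D k β, N.val (N.ext e) (N.tgtN D v).1) *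
          ((∏ _c ∈ T, N.val (N.ext e) a) * ∏ _c ∈ N.Sdem D hk β \ T, N.val (N.ext e) b) := by
    intro T hT
    rw [N.dem_of_ext D hk β _ (N.βadd_mem_Ext D hk β T),
      Finset.prod_union (N.disjoint_demLow_newOut D k β _),
      N.prod_newOut_βadd D hk hku hkind hm' hroot β T (Finset.mem_powerset.1 hT) e]
  rw [Finset.sum_congr rfl this, ← Finset.mul_sum, ← Finset.prod_add, Finset.prod_const,
    N.card_demAt_eq D hk β hval, N.val_eq (N.ext e) k hk, hkind]
  rfl

/-- **The step of the cut induction at a sum node.** [cite: MalodPortier2008, Thm. 2] -/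
theorem step_add (hk : k < N.m) (hku : N.u ≤ k) (hkind : N.kind k = NK.add a b) (hm' : 0 < N.m)
    (hroot : N.fd (N.m - 1) ≤ D) (F : Fin (N.mF D) → (N.Var D → Bool) → R)
    (hF : (N.FS D hD hm' hroot).Admissible F) (β : N.Var D → Bool) (hval : N.Valid D (k + 1) β)
    (IH : ∀ β', N.Valid D k β' → N.W D F k β' = N.RHS D k β') :
    N.W D F (k + 1) β = N.RHS D (k + 1) β := by
  rw [N.W_succ D hD F hF.1 k β, N.sum_Ext_add D hD hk hku hkind hm' hroot F hF β hval,
    ← N.sum_RHS_βadd D hk hku hkind hm' hroot β hval]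
  refine Finset.sum_congr rfl fun T hT => IH _ ?_
  have hTs := Finset.mem_powerset.1 hT
  refine N.valid_of_ext D hk hku β hval _ (N.βadd_mem_Ext D hk β T) (fun c hv j hj hb => ?_)
    (fun c hv j hj j' hj' hjj hb hb' => ?_)
  · rw [N.βadd_tokK D hk] at hb
    split_ifs at hb with h
    · exact (N.mem_Sdem D hk β c).1 (hTs (by simpa using hb))
    · rw [Bool.and_eq_true] at hb
      exact hb.1
  · exfalso
    rw [N.βadd_tokK D hk] at hb hb'
    have h2 : ∀ j : Fin 2, j = 0 ∨ j = 1 := by omega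
    rcases h2 j with rfl | rfl <;> rcases h2 j' with rfl | rfl
    · exact hjj rfl
    · simp at hb hb'
      exact hb'.2 hb
    · simp at hb hb'
      exact hb.2 hb'
    · exact hjj rfl

end StepAdd3

end NCirc

end Literature.Computability.AlgebraicComplexity
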